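import Literature.NumberTheory.Rogawski1990.ArchCartanWallExtensionGDocks    -- ★ (G′-EXT-DOCKS) (LH3-p02 (g2)): `eventually_add_smul_hcNrm_mem_regG`, `hasOneSidedJump_congr`; brings ★ B1 `ArchTransfFamilyWallGeometry` (`hcSwapAt`∕`negXAt` linear, eigen-letters)
import Literature.NumberTheory.Rogawski1990.ArchOrbFamGExtJumpOrderZero      -- ★ p850984 (LH5-p04 (g3)) (I₃)₀ §3: `hcNrm_swap`, `hcCayPt_swap`, `HcSemireg.pair_swap`, `noncompactPair_cases` (order-0 transport; reused, not restated)
import Literature.NumberTheory.Rogawski1990.ArchTransfFamilyJumpKit          -- ★ (LH7-p02 (g2)) PART 2a: `hasOneSidedJump_neg`, `hasOneSidedJump_comp_neg`, `hasOneSidedJump_congr_eventuallyEq` (+ ★ `HasOneSidedJump.const_mul`, `HasOneSidedJump.jump_congr` of `ArchBouazizStableFamilyJumpZero`)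
import Literature.Analysis.Calculus.BoundedJetsLeibnizReflection             -- ★ p850096 (F0P3a-p02 (g19)): `iteratedFDeriv_comp_continuousLinearEquiv_apply`, `iteratedFDeriv_apply_eq_zero_of_comp_eq_self`, `prod_eq_neg_one_pow_card`
import HarnessLib

/-!
# (B-rel) SLOT RELABEL for Harish-Chandra's jump clause (I₃) `ArchHcJump`: the clause at the pair `(j, i)` from the clause at `(i, j)`, and at `(k, j)` from `(i, j)` across a
# realised compact reflection — group-free, from the (W) symmetries alone (Shelstad 1979 §4 (II) p. 23, Lemma 4.3 p. 25, Thm. 4.7 proof p. 31; Bouaziz 1994 §3.2 (I₃))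

Topic `NumberTheory/Rogawski1990`; namespace `Literature.NumberTheory.Rogawski1990`.  THEOREMS ONLY (no `def`, no instance, no notation, no axiom, no named fact, no `sorry`);
kernel lane `--kind proof --supports stmt-HodgeConjecture-24833`.  Cell `pub/hodgecm-mathlib`, crux H413 (`stmt-HodgeConjecture-24833`), F0∕P3c line LH3 (closer stub `stub_N9`,
DIRECT ROAD `F0_P3c_StubN9Direct`, letter L1 `stub_N9hcOrbitalFamilies`, clause (I₃)); brick **(B-rel)** of the (I₃) spec (F0P3a-p08 (g23) `SPEC-I3-jumps` v1.1 §5), road (c)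
«(W)-clause calculus» (LH3-p03 (g5) census 2026-09-02T10:16Z); consumed by (B-asm) `ArchOrbFamGExtJump`.  Author LH3-p03 (g5).

THE MATHEMATICS (`E = W → Fin 3 → ℝ` the coordinate space of ★ (COORD), a compact place `w ∉ S′`, the twisted member `'F_{S′} := archERhoG S′ · F S′` of a Cartan-indexed family
`F`, ★ `hcTwistedDeriv` = its plain iterated Fréchet derivative; the (I₃) clause of ★ `ArchHcJump` at `(S′, w, i, j)`, a wall point `p`, an order `n` and a word `m` of letters
`W × Fin 3` reads: «`ν ↦ Dⁿ'F_{S′}(p + ν•hcNrm w i j)(hcAdaptedVec w i j ∘ m)` has one-sided limits at `0` with jump `J · hcCayScalar w i m · Dⁿ'F_{S″}(hcCayPt w i j p)(hcCayVec w i j ∘ m)`»,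
`S″ = insert w S′`).
* §0 Letter bookkeeping.  Re-lettering a word at the place `w` by a transposition `σ` of two slots: `l ↦ (w, σ l.2)` if `l.1 = w`, `l` otherwise.  Under `(i, j) ↦ (j, i)` (re-letter
  by `swap i j`): the adapted letters agree up to the sign `−1` on the normal letter (`hcAdaptedVec_pair_swap`), the Cayley letters and the Cayley scalar agree exactly
  (`hcNrm w j i = −hcNrm w i j`, `hcCayPt` and `HcSemireg` symmetric: ★ p850984 `hcNrm_swap`, `hcCayPt_swap`, `HcSemireg.pair_swap`, reused).  Under `(k, j) ↦ (i, j)` through the slot swap `A = hcSwapAt w i k` (re-letter by `swap i k`):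
  `A (hcNrm w k j) = hcNrm w i j`, `A ∘ hcAdaptedVec w k j = hcAdaptedVec w i j ∘ re-letter`, `hcCayVec w k j = hcCayVec w i j ∘ re-letter`, `hcCayPt w i j (A p) = hcCayPt w k j p`,
  `HcSemireg S′ w k j p → HcSemireg S′ w i j (A p)`.
* §1 ORIENTATION (`hasOneSidedJump_hcTwistedDeriv_pair_swap`): the clause at `(j, i)` with constant `−J` from the clause at `(i, j)` with constant `J` (re-lettered word), GIVEN only
  that the split member `F S″` is even under `x_w ↦ −x_w` (★ `negXAt w`; = the real half of HC's (W) ★ `ArchHcWeyl`, a theorem for the genuine families ★ `archHcWeyl_orbFamGExt`).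
  Proof: the ray is reparametrised by `ν ↦ −ν` (jump negated, ★ `hasOneSidedJump_comp_neg`), the normal letters flip (multilinearity: factor `(−1)^a`, `a` = number of normal
  letters), the Cayley side is literally the same; for EVEN `a` done, for ODD `a` the Cayley-side word derivative VANISHES — `negXAt w` fixes the Cayley point, preserves
  `'F_{S″}` (★ `archERhoG_negXAt_of_mem` + evenness) and reverses exactly the `a` letters `∂_x` (★ `negXAt_hcCayVec`), so ★ `iteratedFDeriv_apply_eq_zero_of_comp_eq_self` (Shelstad's
  evenness argument, Thm. 4.7 proof p. 31) kills it.  No semiregularity and no smoothness are used.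
* §2 COMPACT SWAP (`hasOneSidedJump_hcTwistedDeriv_slot_swap`): for distinct slots `i, j, k`, the clause at `(k, j)` at a semiregular `p` with constant `−J` from the clause at
  `(i, j)` at `A p` with constant `J` (re-lettered word), GIVEN the FLIP `'F_{S′}(A c) = −'F_{S′}(c)` on the `G`-regular set ★ `RegG S′` (for a realised compact reflection,
  `s w i = s w k`, this is HC's (W) + the alternation of the Weyl denominator: ★ `twisted_hcSwapAt_zero_one` for `(i, k) = (0, 1)` at a covered place).  Proof: the normal ray of `p`
  runs in the OPEN, `A`-stable `RegG S′` for small `ν ≠ 0` (★ `eventually_add_smul_hcNrm_mem_regG`), where `'F∘A = −'F` germ-wise, so the jets negate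
  (★ `Filter.EventuallyEq.iteratedFDeriv`) and ★ `iteratedFDeriv_comp_continuousLinearEquiv_apply` moves `A` onto the point and the letters; ★ `hasOneSidedJump_congr`.
* Clause forms `archHcJump_clause_pair_swap`, `archHcJump_clause_slot_swap` (all `p, n, m` at once: the re-lettering is applied to the given word, no inverse needed).
CONSEQUENCE for the genuine families at a split-chart place (slot signs `(+,+,−)` up to a global sign, ★ `slotSign_of_mem_splitChartPlaces`): the (I₃) clauses at the four
noncompact ordered pairs follow from the one at `(0, 2)`: `jc′₂₀ = −jc′₀₂` (§1), `jc′₁₂ = −jc′₀₂` (§2 with `(i,j,k) = (0,2,1)`), `jc′₂₁ = jc′₀₂` (§2 then §1) — (B-asm).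
HONEST LABEL: HC_CM is proved only modulo the 7 printed citations (2 remaining: hLiu418 = `stmt-HodgeConjecture-24832`, h413 = `stmt-HodgeConjecture-24833`) until rung 0 closes;
count-neutral letter-L1 pay-down ((I₃) bookkeeping; no jump is asserted to exist here).

## References
* [Shelstad1979] D. Shelstad, *Characters and inner forms of a quasi-split group over ℝ*, Compositio Math. 39 (1979) 11–45, §4: property (II) p. 23, Lemma 4.3 p. 25 (the
  Cayley transform of the adapted letters, `∂_α ↦ i∂_x`), Prop. 4.5 p. 26 (`d(α)`), Thm. 4.7 proof p. 31 (evenness in `x` kills the odd normal jets).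
* [Bouaziz1994IntegralesOrbitales] A. Bouaziz, *Intégrales orbitales sur les groupes de Lie réductifs*, Ann. Sci. ÉNS (4) 27 (1994) 573–609, §3.2 (I₃) p. 580, §6.2 p. 591.
* [Varadarajan1977] V. S. Varadarajan, *Harmonic Analysis on Real Reductive Groups*, LNM 576 (1977), Part I §1.12 (the invariant integral and its jump relations).
-/

set_option autoImplicit false

noncomputable section

open Filter Topology Complex Finset
open scoped ContDiff
open Literature.NumberTheory.Automorphic.Shelstad1979.StableOrbitalIntegrals
open Literature.NumberTheory.Automorphic.ArchCartan
open Literature.Analysis.Calculus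

namespace Literature.NumberTheory.Rogawski1990

variable {W : Type*} [DecidableEq W]

/-! ## §0 Letter bookkeeping under a slot transposition at the place `w` -/

section Letters

/-- Re-lettering by the transposition `swap x y` at `w` sends exactly the letter `(w, y)` to `(w, x)`. [cite: Shelstad1979, Lemma 4.3 (p. 25)] -/
theorem reletter_eq_pair_iff (w : W) {x y : Fin 3} (l : W × Fin 3) :
    (if l.1 = w then (l.1, Equiv.swap x y l.2) else l) = (w, x) ↔ l = (w, y) := by
  obtain ⟨w', a⟩ := l
  by_cases hw : w' = w
  · subst hw
    simp only [if_true, Prod.mk.injEq, true_and]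
    rw [Equiv.apply_eq_iff_eq_symm_apply, Equiv.symm_swap, Equiv.swap_apply_left]
  · simp only [hw, if_false, Prod.mk.injEq, false_and]

/-- The Cayley scalar of a re-lettered word: the number of letters `(w, y)` of `m` is the number of letters `(w, x)` of the re-lettered word. [cite: Shelstad1979, Lemma 4.3 (p. 25)] -/
theorem hcCayScalar_reletter (w : W) (x y : Fin 3) {n : ℕ} (m : Fin n → W × Fin 3) :
    hcCayScalar w x (fun r => if (m r).1 = w then ((m r).1, Equiv.swap x y (m r).2) else m r) = hcCayScalar w y m := by
  unfold hcCayScalar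
  congr 2
  ext r
  simp only [Finset.mem_filter, Finset.mem_univ, true_and]
  exact reletter_eq_pair_iff w (m r)

/-- A coordinate vector at one slot, re-read through a transposition: `Pi.single a 1 ∘ swap b c = Pi.single (swap b c a) 1`. [cite: Shelstad1979, Lemma 4.2 (p. 23)] -/
theorem single_one_comp_swap (a b c : Fin 3) : (Pi.single a (1 : ℝ) : Fin 3 → ℝ) ∘ ⇑(Equiv.swap b c) = Pi.single (Equiv.swap b c a) 1 := by
  funext l
  simp only [Function.comp_apply, Pi.single_apply, Equiv.apply_eq_iff_eq_symm_apply, Equiv.symm_swap]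

/-- In `Fin 3`, three pairwise distinct slots exhaust the slots. [cite: Shelstad1979, §4 p. 25] -/
theorem eq_or_eq_or_eq_of_three {i j k : Fin 3} (hij : i ≠ j) (hik : i ≠ k) (hjk : j ≠ k) (l : Fin 3) : l = i ∨ l = j ∨ l = k := by
  revert i j k l; decide

/-! ### `(i, j) ↦ (j, i)` -/

/-- **Adapted letters of `(j, i)` = adapted letters of `(i, j)` re-lettered by `swap i j`, up to the sign `−1` on the normal letter `(w, j)`** (normal `e_j − e_i = −(e_i − e_j)`,
tangential `e_j + e_i = e_i + e_j`, third and foreign letters unchanged). [cite: Shelstad1979, Lemma 4.3 (p. 25)] -/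
theorem hcAdaptedVec_pair_swap (w : W) {i j : Fin 3} (hij : i ≠ j) (l : W × Fin 3) :
    hcAdaptedVec w j i l = (if l = (w, j) then (-1 : ℝ) else 1) • hcAdaptedVec w i j (if l.1 = w then (l.1, Equiv.swap i j l.2) else l) := by
  obtain ⟨w', a⟩ := l
  by_cases hw : w' = w
  · subst hw
    by_cases haj : a = j
    · subst haj
      simp only [hcAdaptedVec, if_true, Equiv.swap_apply_right, neg_smul, one_smul, ← Pi.single_neg, neg_sub]
    · have hne : ((w', a) : W × Fin 3) ≠ (w', j) := fun h => haj (Prod.mk.inj h).2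
      rw [if_neg hne, one_smul]
      by_cases hai : a = i
      · subst hai
        simp only [hcAdaptedVec, if_true, Equiv.swap_apply_left, haj, hij.symm, if_false, add_comm]
      · simp only [hcAdaptedVec, if_true, haj, hai, if_false, Equiv.swap_apply_of_ne_of_ne hai haj]
  · have hne : ((w', a) : W × Fin 3) ≠ (w, j) := fun h => hw (Prod.mk.inj h).1
    simp only [hcAdaptedVec, hw, if_false, hne, one_smul]

/-- **Cayley letters of `(j, i)` = Cayley letters of `(i, j)` re-lettered by `swap i j`** (normal `↦ ∂_x`, tangential `↦ ∂_θ`, third `↦ e_{w,1}` on both sides).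
[cite: Shelstad1979, Lemma 4.3 (p. 25)] -/
theorem hcCayVec_pair_swap (w : W) {i j : Fin 3} (hij : i ≠ j) (l : W × Fin 3) :
    hcCayVec w j i l = hcCayVec w i j (if l.1 = w then (l.1, Equiv.swap i j l.2) else l) := by
  obtain ⟨w', a⟩ := l
  by_cases hw : w' = w
  · subst hw
    by_cases haj : a = j
    · subst haj
      simp only [hcCayVec, if_true, Equiv.swap_apply_right]
    · by_cases hai : a = i
      · subst hai
        simp only [hcCayVec, if_true, Equiv.swap_apply_left, hij.symm, if_false, haj]
      · simp only [hcCayVec, if_true, haj, hai, if_false, Equiv.swap_apply_of_ne_of_ne hai haj]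
  · simp only [hcCayVec, hw, if_false]

/-! ### `(k, j) ↦ (i, j)` through the slot swap `hcSwapAt w i k` -/

/-- **The slot swap `(i k)` carries the normal of `(k, j)` to the normal of `(i, j)`** (`i, j, k` distinct). [cite: Shelstad1979, §4 p. 25] -/
theorem hcSwapAt_hcNrm_of_three (w : W) {i j k : Fin 3} (hij : i ≠ j) (hjk : j ≠ k) :
    hcSwapAt w i k (hcNrm w k j) = hcNrm w i j := by
  rw [hcNrm, hcNrm, hcSwapAt_single_self]
  congr 1
  change ((Pi.single k (1 : ℝ) : Fin 3 → ℝ) - Pi.single j 1) ∘ ⇑(Equiv.swap i k) = _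
  have h : ((Pi.single k (1 : ℝ) : Fin 3 → ℝ) - Pi.single j 1) ∘ ⇑(Equiv.swap i k) =
      (Pi.single k (1 : ℝ) : Fin 3 → ℝ) ∘ ⇑(Equiv.swap i k) - (Pi.single j (1 : ℝ) : Fin 3 → ℝ) ∘ ⇑(Equiv.swap i k) := rfl
  rw [h, single_one_comp_swap, single_one_comp_swap, Equiv.swap_apply_right, Equiv.swap_apply_of_ne_of_ne hij.symm hjk]

/-- **The slot swap `(i k)` carries the adapted letters of `(k, j)` to the adapted letters of `(i, j)`, re-lettered by `swap i k`** (normal `e_k − e_j ↦ e_i − e_j`, tangential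
`e_k + e_j ↦ e_i + e_j`, third `e_i ↦ e_k`, foreign letters fixed). [cite: Shelstad1979, §4 (II) p. 23; Lemma 4.3 (p. 25)] -/
theorem hcSwapAt_hcAdaptedVec_of_three (w : W) {i j k : Fin 3} (hij : i ≠ j) (hik : i ≠ k) (hjk : j ≠ k) (l : W × Fin 3) :
    hcSwapAt w i k (hcAdaptedVec w k j l) = hcAdaptedVec w i j (if l.1 = w then (l.1, Equiv.swap i k l.2) else l) := by
  obtain ⟨w', a⟩ := l
  by_cases hw : w' = w
  · subst hw
    rcases eq_or_eq_or_eq_of_three hij hik hjk a with rfl | rfl | rfl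
    · -- the third letter of `(k, j)`: `e_i ↦ e_k`, the third letter of `(i, j)`
      simp only [hcAdaptedVec, if_true, hik, hij, if_false, Equiv.swap_apply_left, hik.symm, hjk.symm, hcSwapAt_single_self, single_one_comp_swap]
    · -- the tangential letter
      simp only [hcAdaptedVec, if_true, hjk, if_false, Equiv.swap_apply_of_ne_of_ne hij.symm hjk, hij.symm, hcSwapAt_single_self]
      congr 1
      change ((Pi.single k (1 : ℝ) : Fin 3 → ℝ) + Pi.single a 1) ∘ ⇑(Equiv.swap i k) = _
      have h : ((Pi.single k (1 : ℝ) : Fin 3 → ℝ) + Pi.single a 1) ∘ ⇑(Equiv.swap i k) =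
          (Pi.single k (1 : ℝ) : Fin 3 → ℝ) ∘ ⇑(Equiv.swap i k) + (Pi.single a (1 : ℝ) : Fin 3 → ℝ) ∘ ⇑(Equiv.swap i k) := rfl
      rw [h, single_one_comp_swap, single_one_comp_swap, Equiv.swap_apply_right, Equiv.swap_apply_of_ne_of_ne hij.symm hjk]
    · -- the normal letter
      simp only [hcAdaptedVec, if_true, Equiv.swap_apply_right, hcSwapAt_single_self]
      congr 1
      change ((Pi.single a (1 : ℝ) : Fin 3 → ℝ) - Pi.single j 1) ∘ ⇑(Equiv.swap i a) = _
      have h : ((Pi.single a (1 : ℝ) : Fin 3 → ℝ) - Pi.single j 1) ∘ ⇑(Equiv.swap i a) =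
          (Pi.single a (1 : ℝ) : Fin 3 → ℝ) ∘ ⇑(Equiv.swap i a) - (Pi.single j (1 : ℝ) : Fin 3 → ℝ) ∘ ⇑(Equiv.swap i a) := rfl
      rw [h, single_one_comp_swap, single_one_comp_swap, Equiv.swap_apply_right, Equiv.swap_apply_of_ne_of_ne hij.symm hjk]
  · simp only [hcAdaptedVec, hw, if_false, hcSwapAt_single_of_ne hw]

/-- **Cayley letters of `(k, j)` = Cayley letters of `(i, j)` re-lettered by `swap i k`.** [cite: Shelstad1979, Lemma 4.3 (p. 25)] -/
theorem hcCayVec_of_three (w : W) {i j k : Fin 3} (hij : i ≠ j) (hik : i ≠ k) (hjk : j ≠ k) (l : W × Fin 3) :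
    hcCayVec w k j l = hcCayVec w i j (if l.1 = w then (l.1, Equiv.swap i k l.2) else l) := by
  obtain ⟨w', a⟩ := l
  by_cases hw : w' = w
  · subst hw
    rcases eq_or_eq_or_eq_of_three hij hik hjk a with rfl | rfl | rfl
    · simp only [hcCayVec, if_true, hik, hij, if_false, Equiv.swap_apply_left, hik.symm, hjk.symm]
    · simp only [hcCayVec, if_true, hjk, if_false, Equiv.swap_apply_of_ne_of_ne hij.symm hjk, hij.symm]
    · simp only [hcCayVec, if_true, Equiv.swap_apply_right]
  · simp only [hcCayVec, hw, if_false]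

/-- **The Cayley point of `A p` at `(i, j)` is the Cayley point of `p` at `(k, j)`**, `A = hcSwapAt w i k` (third angle `p_i`, mean of `p_k, p_j`).
[cite: Shelstad1979, §4 p. 25] -/
theorem hcCayPt_hcSwapAt_of_three (w : W) {i j k : Fin 3} (hij : i ≠ j) (hik : i ≠ k) (hjk : j ≠ k) (p : W → Fin 3 → ℝ) :
    hcCayPt w i j (hcSwapAt w i k p) = hcCayPt w k j p := by
  have h3ij : hcThird i j = k := (eq_hcThird_of_ne_of_ne hij hik.symm hjk.symm).symm
  have h3kj : hcThird k j = i := (eq_hcThird_of_ne_of_ne hjk.symm hik hij).symm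
  funext w' l
  by_cases hw : w' = w
  · subst hw
    obtain ⟨hpi, hpk⟩ := hcSwapAt_apply_pair w' i k p
    have hpj : hcSwapAt w' i k p w' j = p w' j := hcSwapAt_apply_self_of_ne w' hij.symm hjk p
    rw [hcCayPt, hcCayPt, Function.update_self, Function.update_self, h3ij, h3kj, hpk, hpi, hpj]
  · rw [hcCayPt_apply_of_ne hw, hcCayPt_apply_of_ne hw, hcSwapAt_apply_of_ne hw]


/-- **Semiregularity transported through the slot swap**: `p` semiregular on the wall `(k, j)` ⇒ `hcSwapAt w i k p` semiregular on the wall `(i, j)`.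
[cite: Shelstad1979, §4 p. 22] -/
theorem HcSemireg.hcSwapAt_of_three {S' : Finset W} {w : W} (hw : w ∉ S') {i j k : Fin 3} (hij : i ≠ j) (hik : i ≠ k) (hjk : j ≠ k)
    {p : W → Fin 3 → ℝ} (hp : HcSemireg S' w k j p) : HcSemireg S' w i j (hcSwapAt w i k p) := by
  have h3ij : hcThird i j = k := (eq_hcThird_of_ne_of_ne hij hik.symm hjk.symm).symm
  have h3kj : hcThird k j = i := (eq_hcThird_of_ne_of_ne hjk.symm hik hij).symm
  obtain ⟨h1, h2, h3, h4⟩ := hp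
  obtain ⟨hpi, hpk⟩ := hcSwapAt_apply_pair w i k p
  have hpj : hcSwapAt w i k p w j = p w j := hcSwapAt_apply_self_of_ne w hij.symm hjk p
  refine ⟨by rw [hpi, hpj, h1], ?_, fun w' hw' hne => ?_, fun w' hw' => ?_⟩
  · rw [h3ij, hpk, hpi]
    rw [h3kj] at h2
    exact h2
  · have e : hcSwapAt w i k p w' = p w' := hcSwapAt_apply_of_ne hne i k p
    simp only [e]
    exact h3 w' hw' hne
  · have hne : w' ≠ w := fun h => hw (h ▸ hw')
    rw [hcSwapAt_apply_of_ne hne]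
    exact h4 w' hw'

end Letters

/-! ## §1 ORIENTATION: the clause at `(j, i)` from the clause at `(i, j)` -/

section Orientation

variable [Fintype W]

/-- **(I₃) AT THE REVERSED PAIR.**  Let the split member `F (insert w S′)` be even under `x_w ↦ −x_w` (★ `negXAt w`; the real half of HC's (W)).  If the twisted word derivative of
`F S′` at the pair `(i, j)` — word `m` re-lettered by `swap i j` — has the one-sided jump `J · hcCayScalar · (Cayley word derivative)` along `p + ν•hcNrm w i j`, then at the pair
`(j, i)` the word `m` has the one-sided jump with constant `−J`: the ray is reversed (`hcNrm w j i = −hcNrm w i j`), the `a` normal letters flip (factor `(−1)^a`), the Cayley side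
is the same, and for odd `a` the Cayley-side derivative vanishes (an odd number of `∂_x` letters on the `x_w`-even `'F_{S″}` at the point `x_w = 0`; Shelstad's argument).
No semiregularity and no smoothness hypothesis. [cite: Shelstad1979, Lemma 4.3 (p. 25); Thm. 4.7 proof p. 31] [cite: Bouaziz1994IntegralesOrbitales, §3.2 (I₃) p. 580] -/
theorem hasOneSidedJump_hcTwistedDeriv_pair_swap
    {F : Finset W → (W → Fin 3 → ℝ) → ℂ} {S' : Finset W} {w : W} {i j : Fin 3} (hij : i ≠ j)
    (heven : ∀ c, F (insert w S') (negXAt w c) = F (insert w S') c)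
    (p : W → Fin 3 → ℝ) {J : ℂ} (n : ℕ) (m : Fin n → W × Fin 3)
    (h : HasOneSidedJump
        (fun ν : ℝ => hcTwistedDeriv S' n
          (fun r => hcAdaptedVec w i j (if (m r).1 = w then ((m r).1, Equiv.swap i j (m r).2) else m r)) (F S') (p + ν • hcNrm w i j))
        (J * hcCayScalar w i (fun r => if (m r).1 = w then ((m r).1, Equiv.swap i j (m r).2) else m r) *
          hcTwistedDeriv (insert w S') n
            (fun r => hcCayVec w i j (if (m r).1 = w then ((m r).1, Equiv.swap i j (m r).2) else m r)) (F (insert w S')) (hcCayPt w i j p))) :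
    HasOneSidedJump (fun ν : ℝ => hcTwistedDeriv S' n (fun r => hcAdaptedVec w j i (m r)) (F S') (p + ν • hcNrm w j i))
      (-J * hcCayScalar w j m * hcTwistedDeriv (insert w S') n (fun r => hcCayVec w j i (m r)) (F (insert w S')) (hcCayPt w j i p)) := by
  -- the letter signs: `−1` on the normal letters `(w, j)` of the pair `(j, i)`
  set ε : Fin n → ℝ := fun r => if m r = (w, j) then (-1 : ℝ) else 1 with hε
  have hε1 : ∀ r, ε r = 1 ∨ ε r = -1 := fun r => by
    simp only [hε]
    split_ifs
    · exact Or.inr rfl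
    · exact Or.inl rfl
  -- the Cayley data agree
  have hS : hcCayScalar w j m = hcCayScalar w i (fun r => if (m r).1 = w then ((m r).1, Equiv.swap i j (m r).2) else m r) :=
    (hcCayScalar_reletter w i j m).symm
  have hV : (fun r => hcCayVec w j i (m r)) = fun r => hcCayVec w i j (if (m r).1 = w then ((m r).1, Equiv.swap i j (m r).2) else m r) :=
    funext fun r => hcCayVec_pair_swap w hij (m r)
  have hP : hcCayPt w j i p = hcCayPt w i j p := hcCayPt_swap w i j p
  -- the left side is `(∏ ε) ·` the `(i, j)`-side read at `−ν`
  have hL : (fun ν : ℝ => hcTwistedDeriv S' n (fun r => hcAdaptedVec w j i (m r)) (F S') (p + ν • hcNrm w j i)) =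
      fun ν : ℝ => ((∏ r, ε r : ℝ) : ℂ) *
        hcTwistedDeriv S' n (fun r => hcAdaptedVec w i j (if (m r).1 = w then ((m r).1, Equiv.swap i j (m r).2) else m r)) (F S') (p + (-ν) • hcNrm w i j) := by
    funext ν
    have hdirs : (fun r => hcAdaptedVec w j i (m r)) =
        fun r => ε r • hcAdaptedVec w i j (if (m r).1 = w then ((m r).1, Equiv.swap i j (m r).2) else m r) :=
      funext fun r => hcAdaptedVec_pair_swap w hij (m r)
    unfold hcTwistedDeriv
    rw [hdirs, ContinuousMultilinearMap.map_smul_univ, hcNrm_swap, smul_neg, ← neg_smul, Complex.real_smul]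
  -- reflect the ray and scale: the jump becomes `(∏ ε) · (−(J·S·D))`
  have h2 := HasOneSidedJump.const_mul ((∏ r, ε r : ℝ) : ℂ) (hasOneSidedJump_comp_neg h)
  rw [hL]
  rcases Nat.even_or_odd (Finset.univ.filter fun r => ε r = -1).card with hev | hodd
  · -- even number of normal letters: `∏ ε = 1`
    have hprod : ((∏ r, ε r : ℝ) : ℂ) = 1 := by
      rw [prod_eq_neg_one_pow_card hε1, hev.neg_one_pow, Complex.ofReal_one]
    exact HasOneSidedJump.jump_congr h2 (by rw [hS, hV, hP, hprod]; ring)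
  · -- odd number of normal letters: the Cayley-side word derivative vanishes
    have hprod : ∏ r, ε r = -1 := by rw [prod_eq_neg_one_pow_card hε1, hodd.neg_one_pow]
    have hD0 : hcTwistedDeriv (insert w S') n
        (fun r => hcCayVec w i j (if (m r).1 = w then ((m r).1, Equiv.swap i j (m r).2) else m r)) (F (insert w S')) (hcCayPt w i j p) = 0 := by
      obtain ⟨R, hR⟩ := exists_continuousLinearEquiv_negXAt (W := W) w
      have hcomp : (fun c => archERhoG (insert w S') c * F (insert w S') c) ∘ R = fun c => archERhoG (insert w S') c * F (insert w S') c := by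
        funext c
        simp only [Function.comp_apply, hR, archERhoG_negXAt_of_mem (Finset.mem_insert_self w S'), heven]
      have hx : R (hcCayPt w i j p) = hcCayPt w i j p := by rw [hR, negXAt_hcCayPt]
      have hm : ∀ r, R (hcCayVec w i j (if (m r).1 = w then ((m r).1, Equiv.swap i j (m r).2) else m r)) =
          ε r • hcCayVec w i j (if (m r).1 = w then ((m r).1, Equiv.swap i j (m r).2) else m r) := by
        intro r
        rw [hR, negXAt_hcCayVec]
        congr 1
        simp only [hε, reletter_eq_pair_iff]
      unfold hcTwistedDeriv
      exact iteratedFDeriv_apply_eq_zero_of_comp_eq_self R hcomp hx n hm hprod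
    exact HasOneSidedJump.jump_congr h2 (by rw [hS, hV, hP, hD0]; ring)

/-- **(I₃) AT THE REVERSED PAIR, CLAUSE FORM**: if the clause of ★ `ArchHcJump` holds at `(S′, w, i, j)` for all semiregular `p`, all orders and all words with the constant `J`,
it holds at `(S′, w, j, i)` with the constant `−J` (semiregularity is symmetric in the pair; apply the above to the re-lettered word).
[cite: Shelstad1979, Prop. 4.5 (p. 26); Thm. 4.7 proof p. 31] [cite: Bouaziz1994IntegralesOrbitales, §3.2 (I₃) p. 580] -/
theorem archHcJump_clause_pair_swap
    {F : Finset W → (W → Fin 3 → ℝ) → ℂ} {S' : Finset W} {w : W} {i j : Fin 3} (hij : i ≠ j)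
    (heven : ∀ c, F (insert w S') (negXAt w c) = F (insert w S') c) {J : ℂ}
    (h : ∀ p : W → Fin 3 → ℝ, HcSemireg S' w i j p → ∀ (n : ℕ) (m : Fin n → W × Fin 3),
      HasOneSidedJump (fun ν : ℝ => hcTwistedDeriv S' n (fun r => hcAdaptedVec w i j (m r)) (F S') (p + ν • hcNrm w i j))
        (J * hcCayScalar w i m * hcTwistedDeriv (insert w S') n (fun r => hcCayVec w i j (m r)) (F (insert w S')) (hcCayPt w i j p))) :
    ∀ p : W → Fin 3 → ℝ, HcSemireg S' w j i p → ∀ (n : ℕ) (m : Fin n → W × Fin 3),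
      HasOneSidedJump (fun ν : ℝ => hcTwistedDeriv S' n (fun r => hcAdaptedVec w j i (m r)) (F S') (p + ν • hcNrm w j i))
        (-J * hcCayScalar w j m * hcTwistedDeriv (insert w S') n (fun r => hcCayVec w j i (m r)) (F (insert w S')) (hcCayPt w j i p)) :=
  fun p hp n m => hasOneSidedJump_hcTwistedDeriv_pair_swap hij heven p n m (h p hp.pair_swap n _)

end Orientation

/-! ## §2 COMPACT SWAP: the clause at `(k, j)` from the clause at `(i, j)` across the realised reflection `hcSwapAt w i k` -/

section SlotSwap

variable [Fintype W]

/-- **(I₃) ACROSS A REALISED COMPACT REFLECTION.**  Let `i, j, k` be distinct slots, `w ∉ S′`, and let the twisted member FLIP under the slot swap `A = hcSwapAt w i k` on the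
`G`-regular set: `'F_{S′}(A c) = −'F_{S′}(c)` for `c ∈ RegG S′` (HC's (W) for a realised reflection + the alternation of the Weyl denominator; ★ `twisted_hcSwapAt_zero_one`).  If
at the semiregular point `A p` of the wall `(i, j)` the re-lettered word has the one-sided jump `J · hcCayScalar · (Cayley word derivative)`, then at the semiregular point `p` of
the wall `(k, j)` the word `m` has the one-sided jump with constant `−J`: `A` carries the normal ray and the adapted letters of `(k, j)` onto those of `(i, j)`, the ray runs in
the open `A`-stable `RegG S′` for small `ν ≠ 0` where the jets of `'F∘A = −'F` negate, and the Cayley data of the two readings coincide.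
[cite: Shelstad1979, §4 property (II) p. 23; Lemma 4.3 (p. 25); Prop. 4.5 (p. 26)] [cite: Bouaziz1994IntegralesOrbitales, §3.2 (I₃) p. 580] -/
theorem hasOneSidedJump_hcTwistedDeriv_slot_swap
    {F : Finset W → (W → Fin 3 → ℝ) → ℂ} {S' : Finset W} {w : W} (hw : w ∉ S') {i j k : Fin 3} (hij : i ≠ j) (hik : i ≠ k) (hjk : j ≠ k)
    (hflip : ∀ c ∈ RegG S', archERhoG S' (hcSwapAt w i k c) * F S' (hcSwapAt w i k c) = -(archERhoG S' c * F S' c))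
    {p : W → Fin 3 → ℝ} (hp : HcSemireg S' w k j p) {J : ℂ} (n : ℕ) (m : Fin n → W × Fin 3)
    (h : HasOneSidedJump
        (fun ν : ℝ => hcTwistedDeriv S' n
          (fun r => hcAdaptedVec w i j (if (m r).1 = w then ((m r).1, Equiv.swap i k (m r).2) else m r)) (F S') (hcSwapAt w i k p + ν • hcNrm w i j))
        (J * hcCayScalar w i (fun r => if (m r).1 = w then ((m r).1, Equiv.swap i k (m r).2) else m r) *
          hcTwistedDeriv (insert w S') n
            (fun r => hcCayVec w i j (if (m r).1 = w then ((m r).1, Equiv.swap i k (m r).2) else m r)) (F (insert w S')) (hcCayPt w i j (hcSwapAt w i k p)))) :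
    HasOneSidedJump (fun ν : ℝ => hcTwistedDeriv S' n (fun r => hcAdaptedVec w k j (m r)) (F S') (p + ν • hcNrm w k j))
      (-J * hcCayScalar w k m * hcTwistedDeriv (insert w S') n (fun r => hcCayVec w k j (m r)) (F (insert w S')) (hcCayPt w k j p)) := by
  obtain ⟨A, hA⟩ := exists_continuousLinearEquiv_hcSwapAt (W := W) w i k
  -- the Cayley data agree
  have hS : hcCayScalar w i (fun r => if (m r).1 = w then ((m r).1, Equiv.swap i k (m r).2) else m r) = hcCayScalar w k m :=
    hcCayScalar_reletter w i k m
  have hV : (fun r => hcCayVec w i j (if (m r).1 = w then ((m r).1, Equiv.swap i k (m r).2) else m r)) = fun r => hcCayVec w k j (m r) :=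
    funext fun r => (hcCayVec_of_three w hij hik hjk (m r)).symm
  have hP : hcCayPt w i j (hcSwapAt w i k p) = hcCayPt w k j p := hcCayPt_hcSwapAt_of_three w hij hik hjk p
  refine hasOneSidedJump_congr_eventuallyEq (HasOneSidedJump.jump_congr (hasOneSidedJump_neg h) (by rw [hS, hV, hP]; ring)) ?_
  filter_upwards [eventually_add_smul_hcNrm_mem_regG hw hjk.symm hp] with ν hν
  have hpt : hcSwapAt w i k p + ν • hcNrm w i j = A (p + ν • hcNrm w k j) := by
    rw [hA, hcSwapAt_add_smul, hcSwapAt_hcNrm_of_three w hij hjk]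
  have hdirs : (fun r => hcAdaptedVec w i j (if (m r).1 = w then ((m r).1, Equiv.swap i k (m r).2) else m r)) =
      ⇑A ∘ fun r => hcAdaptedVec w k j (m r) := by
    funext r
    simp only [Function.comp_apply, hA, hcSwapAt_hcAdaptedVec_of_three w hij hik hjk (m r)]
  have hgerm : ((fun c => archERhoG S' c * F S' c) ∘ ⇑A) =ᶠ[𝓝 (p + ν • hcNrm w k j)] -(fun c => archERhoG S' c * F S' c) := by
    filter_upwards [(isOpen_regG S').mem_nhds hν] with c hc
    simp only [Function.comp_apply, Pi.neg_apply, hA]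
    exact hflip c hc
  unfold hcTwistedDeriv
  rw [hpt, hdirs, ← iteratedFDeriv_comp_continuousLinearEquiv_apply, (hgerm.iteratedFDeriv ℝ n).self_of_nhds, iteratedFDeriv_neg_apply,
    _root_.neg_apply, neg_neg]

/-- **(I₃) ACROSS A REALISED COMPACT REFLECTION, CLAUSE FORM**: the clause of ★ `ArchHcJump` at `(S′, w, i, j)` with the constant `J` (all semiregular `p`, orders, words)
gives the clause at `(S′, w, k, j)` with the constant `−J`. [cite: Shelstad1979, Prop. 4.5 (p. 26); Thm. 4.7 (IIIb) p. 31] [cite: Bouaziz1994IntegralesOrbitales, §3.2 (I₃) p. 580] -/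
theorem archHcJump_clause_slot_swap
    {F : Finset W → (W → Fin 3 → ℝ) → ℂ} {S' : Finset W} {w : W} (hw : w ∉ S') {i j k : Fin 3} (hij : i ≠ j) (hik : i ≠ k) (hjk : j ≠ k)
    (hflip : ∀ c ∈ RegG S', archERhoG S' (hcSwapAt w i k c) * F S' (hcSwapAt w i k c) = -(archERhoG S' c * F S' c)) {J : ℂ}
    (h : ∀ p : W → Fin 3 → ℝ, HcSemireg S' w i j p → ∀ (n : ℕ) (m : Fin n → W × Fin 3),
      HasOneSidedJump (fun ν : ℝ => hcTwistedDeriv S' n (fun r => hcAdaptedVec w i j (m r)) (F S') (p + ν • hcNrm w i j))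
        (J * hcCayScalar w i m * hcTwistedDeriv (insert w S') n (fun r => hcCayVec w i j (m r)) (F (insert w S')) (hcCayPt w i j p))) :
    ∀ p : W → Fin 3 → ℝ, HcSemireg S' w k j p → ∀ (n : ℕ) (m : Fin n → W × Fin 3),
      HasOneSidedJump (fun ν : ℝ => hcTwistedDeriv S' n (fun r => hcAdaptedVec w k j (m r)) (F S') (p + ν • hcNrm w k j))
        (-J * hcCayScalar w k m * hcTwistedDeriv (insert w S') n (fun r => hcCayVec w k j (m r)) (F (insert w S')) (hcCayPt w k j p)) :=
  fun _ hp n m => hasOneSidedJump_hcTwistedDeriv_slot_swap hw hij hik hjk hflip hp n m (h _ (hp.hcSwapAt_of_three hw hij hik hjk) n _)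

end SlotSwap

end Literature.NumberTheory.Rogawski1990

end
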